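import Summits.Ventures.YMGap.RobustBall.StringTensionOnBall
import Summits.Ventures.YMGap.RobustBall.AreaLawRadius
import Summits.Ventures.YMGap.RobustBall.AreaLawFrontierSU2
import HarnessLib

/-!
# Robust ball (Y2), area-law side — string tension on the ball: the `∀ L` forms, the whole `SU(2)` window, and the frontier cells

HONEST FRAMING: venture file of the cell `pub-ymgap` (QuantumFields programme), track ROBUST-BALL, seat rb-p2 (g2).  Strong-coupling LATTICE
statements; nothing about the continuum, a spectral mass gap, or Clay.  COROLLARIES ONLY (no new mechanism):
1. the `∀ L` membership forms of `hasAreaLawWith_onBall` / `stringTension_onBall` (families whose member lies in the ball on EVERY torus — the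
   form the cell's statement document cites; the eventual form is the landed one);
2. `SU(2)` in every dimension `d = n + 1 ≥ 2` and at EVERY Wilson coupling of the window `0 ≤ β_W`, `nβ_W < 2` (`d = 4`: `β_W < 2/3`): string
   tension on the ball of radius `ε(β_W) = (2 − nβ_W)/10` (`AreaLawRadius.su2_areaLawOnBall_radius` fed to `stringTension_onBall`) — ONE pair
   `(C, c)`, `c > 0`, per coupling, serving every infinite-volume limit state of every member family of that ball; `d = 4` reading with the tree's
   `suFundStringTension`;
3. the thirteen certified FRONTIER cells of `AreaLawFrontierSU2` in the string-tension currency (three written out: `(1/8, .407)`, `(1/3, .159)`,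
   `(1/2, .062)`; the rest are the same one-liner `suFundStringTension_ge_onBall (su2_frontier_… r hmv)`).
NOT CLAIMED: existence of the string tension for members (no reflection positivity for a generic `W`); the radii are door artefacts.
-/

noncomputable section

open MeasureTheory Filter Topology
open Literature.MathematicalPhysics.QuantumLattice
open Literature.MathematicalPhysics.QuantumFieldTheory hiding ZdEdge Site
open Literature.Barriers.QuantumFields (suFundStringTension)

namespace Summit.Ventures.YMGap.RobustBall

variable {d N : ℕ}

/-! ### 1. The `∀ L` forms -/

/-- **String tension on the ball, `∀ L` membership form.**  Under `AreaLawOnBall N d β ε₀ ε₁ r mv` (`d ≥ 2`): one pair `(C, c)`, `c > 0`, such that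
for every family `𝓦` with `𝓦 L ∈ ClusterDomainFR ε₀ ε₁ r` and `IsSlabLocal mv (𝓦 L)` for EVERY `L`, every `μ ∈ perturbedLimitPoints β 𝓦` obeys
`HasAreaLawWith μ χ_N C c`, `HasAreaLawState μ χ_N`, `σ ≥ c` whenever `HasStringTension μ χ_N σ`, and `IsConfining μ χ_N` given existence of `σ`.
[folklore] -/
theorem stringTension_onBall_forall [NeZero d] (hd : 2 ≤ d) {β ε₀ ε₁ : ℝ} {r mv : ℕ} (h : AreaLawOnBall N d β ε₀ ε₁ r mv) :
    ∃ C c : ℝ, 0 < c ∧ ∀ 𝓦 : PerturbationFamily d N,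
      (∀ L : ℕ, 𝓦 L ∈ ClusterDomainFR ε₀ ε₁ r ∧ IsSlabLocal mv (𝓦 L)) →
        ∀ μ ∈ perturbedLimitPoints β 𝓦,
          HasAreaLawWith μ (fun g => normalisedCharacter N (fundamentalRep (Fin N) g)) C c ∧
          HasAreaLawState μ (fun g => normalisedCharacter N (fundamentalRep (Fin N) g)) ∧
          (∀ σ : ℝ, HasStringTension μ (fun g => normalisedCharacter N (fundamentalRep (Fin N) g)) σ → c ≤ σ) ∧
          ((∃ σ : ℝ, HasStringTension μ (fun g => normalisedCharacter N (fundamentalRep (Fin N) g)) σ) →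
            IsConfining μ (fun g => normalisedCharacter N (fundamentalRep (Fin N) g))) := by
  obtain ⟨C, c, hc, hA⟩ := stringTension_onBall hd h
  exact ⟨C, c, hc, fun 𝓦 h𝓦 μ hμ => hA 𝓦 (Eventually.of_forall h𝓦) μ hμ⟩

/-- The `d = 4`, `∀ L` form with the tree's named string tension: `c ≤ suFundStringTension N μ` whenever the string tension exists. [folklore] -/
theorem suFundStringTension_ge_onBall_forall {β ε₀ ε₁ : ℝ} {r mv : ℕ} (h : AreaLawOnBall N 4 β ε₀ ε₁ r mv) :
    ∃ C c : ℝ, 0 < c ∧ ∀ 𝓦 : PerturbationFamily 4 N,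
      (∀ L : ℕ, 𝓦 L ∈ ClusterDomainFR ε₀ ε₁ r ∧ IsSlabLocal mv (𝓦 L)) →
        ∀ μ ∈ perturbedLimitPoints β 𝓦,
          HasAreaLawWith μ (fun g => normalisedCharacter N (fundamentalRep (Fin N) g)) C c ∧
          ((∃ σ : ℝ, HasStringTension μ (fun g => normalisedCharacter N (fundamentalRep (Fin N) g)) σ) →
            c ≤ suFundStringTension N μ) := by
  obtain ⟨C, c, hc, hA⟩ := suFundStringTension_ge_onBall h
  exact ⟨C, c, hc, fun 𝓦 h𝓦 μ hμ => hA 𝓦 (Eventually.of_forall h𝓦) μ hμ⟩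

/-! ### 2. `SU(2)`: the whole Wilson window -/

/-- **`SU(2)`, EVERY `d = n + 1 ≥ 2`, EVERY coupling of the window: string tension on the ball of radius `(2 − nβ_W)/10`.**  For `0 ≤ β_W`,
`nβ_W < 2` there is one pair `(C, c)`, `c > 0`, such that every infinite-volume limit state of every family eventually in
`ClusterDomainFR ((2 − nβ_W)/5) ((2 − nβ_W)/10) r ∩ IsSlabLocal mv` (tree coupling `β_W/2`) obeys `HasAreaLawWith μ χ₂ C c` and has string tension
`≥ c` whenever it exists. [folklore] -/
theorem su2_stringTension_onBall_radius {n : ℕ} (hn : 1 ≤ n) {βW : ℝ} (hβ : 0 ≤ βW) (hlt : (n : ℝ) * βW < 2) (r : ℕ) {mv : ℕ}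
    (hmv : 1 ≤ mv) :
    ∃ C c : ℝ, 0 < c ∧ ∀ 𝓦 : PerturbationFamily (n + 1) 2,
      (∀ᶠ L : ℕ in atTop, 𝓦 L ∈ ClusterDomainFR ((2 - n * βW) / 5) ((2 - n * βW) / 10) r ∧ IsSlabLocal mv (𝓦 L)) →
        ∀ μ ∈ perturbedLimitPoints (βW / 2) 𝓦,
          HasAreaLawWith μ (fun g => normalisedCharacter 2 (fundamentalRep (Fin 2) g)) C c ∧
          (∀ σ : ℝ, HasStringTension μ (fun g => normalisedCharacter 2 (fundamentalRep (Fin 2) g)) σ → c ≤ σ) := by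
  haveI : NeZero (n + 1) := ⟨by omega⟩
  obtain ⟨C, c, hc, hA⟩ := stringTension_onBall (N := 2) (d := n + 1) (by omega) (su2_areaLawOnBall_radius hβ hlt r hmv)
  exact ⟨C, c, hc, fun 𝓦 h𝓦 μ hμ => ⟨(hA 𝓦 h𝓦 μ hμ).1, (hA 𝓦 h𝓦 μ hμ).2.2.1⟩⟩

/-- **`SU(2)`, `d = 4`, EVERY `0 ≤ β_W < 2/3`: string tension on the ball of radius `(2 − 3β_W)/10`**, with the tree's named string tension:
one `c > 0` per coupling with `HasAreaLawWith μ χ₂ C c` and `c ≤ suFundStringTension 2 μ` (whenever it exists) for every infinite-volume limit state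
of every family eventually in `ClusterDomainFR ((2 − 3β_W)/5) ((2 − 3β_W)/10) r ∩ IsSlabLocal mv`. [folklore] -/
theorem su2_stringTension_onBall_radius_dim4 {βW : ℝ} (hβ : 0 ≤ βW) (hlt : βW < 2 / 3) (r : ℕ) {mv : ℕ} (hmv : 1 ≤ mv) :
    ∃ C c : ℝ, 0 < c ∧ ∀ 𝓦 : PerturbationFamily 4 2,
      (∀ᶠ L : ℕ in atTop, 𝓦 L ∈ ClusterDomainFR ((2 - 3 * βW) / 5) ((2 - 3 * βW) / 10) r ∧ IsSlabLocal mv (𝓦 L)) →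
        ∀ μ ∈ perturbedLimitPoints (βW / 2) 𝓦,
          HasAreaLawWith μ (fun g => normalisedCharacter 2 (fundamentalRep (Fin 2) g)) C c ∧
          ((∃ σ : ℝ, HasStringTension μ (fun g => normalisedCharacter 2 (fundamentalRep (Fin 2) g)) σ) →
            c ≤ suFundStringTension 2 μ) :=
  suFundStringTension_ge_onBall (su2_areaLawOnBall_radius_dim4 hβ hlt r hmv)

/-! ### 3. Frontier cells in the string-tension currency (`SU(2)`, `d = 4`) -/

/-- Frontier cell `(β_W, ε) = (1/8, 0.407)`: string tension on the ball `(407/500, 407/1000)` at tree coupling `1/16`. [folklore] -/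
theorem su2_stringTension_frontier_1_8 (r : ℕ) {mv : ℕ} (hmv : 1 ≤ mv) :
    ∃ C c : ℝ, 0 < c ∧ ∀ 𝓦 : PerturbationFamily 4 2,
      (∀ᶠ L : ℕ in atTop, 𝓦 L ∈ ClusterDomainFR (407 / 500) (407 / 1000) r ∧ IsSlabLocal mv (𝓦 L)) →
        ∀ μ ∈ perturbedLimitPoints (1 / 16) 𝓦,
          HasAreaLawWith μ (fun g => normalisedCharacter 2 (fundamentalRep (Fin 2) g)) C c ∧
          ((∃ σ : ℝ, HasStringTension μ (fun g => normalisedCharacter 2 (fundamentalRep (Fin 2) g)) σ) →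
            c ≤ suFundStringTension 2 μ) :=
  suFundStringTension_ge_onBall (su2_frontier_1_8 r hmv)

/-- Frontier cell `(β_W, ε) = (1/3, 0.159)`: string tension on the ball `(159/500, 159/1000)` at tree coupling `1/6` (supersedes the radius `0.15`
of `su2_stringTension_onBall_oneThird` as the largest certified). [folklore] -/
theorem su2_stringTension_frontier_1_3 (r : ℕ) {mv : ℕ} (hmv : 1 ≤ mv) :
    ∃ C c : ℝ, 0 < c ∧ ∀ 𝓦 : PerturbationFamily 4 2,
      (∀ᶠ L : ℕ in atTop, 𝓦 L ∈ ClusterDomainFR (159 / 500) (159 / 1000) r ∧ IsSlabLocal mv (𝓦 L)) →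
        ∀ μ ∈ perturbedLimitPoints (1 / 6) 𝓦,
          HasAreaLawWith μ (fun g => normalisedCharacter 2 (fundamentalRep (Fin 2) g)) C c ∧
          ((∃ σ : ℝ, HasStringTension μ (fun g => normalisedCharacter 2 (fundamentalRep (Fin 2) g)) σ) →
            c ≤ suFundStringTension 2 μ) :=
  suFundStringTension_ge_onBall (su2_frontier_1_3 r hmv)

/-- Frontier cell `(β_W, ε) = (1/2, 0.062)`: string tension on the ball `(31/250, 31/500)` at tree coupling `1/4`. [folklore] -/
theorem su2_stringTension_frontier_1_2 (r : ℕ) {mv : ℕ} (hmv : 1 ≤ mv) :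
    ∃ C c : ℝ, 0 < c ∧ ∀ 𝓦 : PerturbationFamily 4 2,
      (∀ᶠ L : ℕ in atTop, 𝓦 L ∈ ClusterDomainFR (31 / 250) (31 / 500) r ∧ IsSlabLocal mv (𝓦 L)) →
        ∀ μ ∈ perturbedLimitPoints (1 / 4) 𝓦,
          HasAreaLawWith μ (fun g => normalisedCharacter 2 (fundamentalRep (Fin 2) g)) C c ∧
          ((∃ σ : ℝ, HasStringTension μ (fun g => normalisedCharacter 2 (fundamentalRep (Fin 2) g)) σ) →
            c ≤ suFundStringTension 2 μ) :=
  suFundStringTension_ge_onBall (su2_frontier_1_2 r hmv)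

end Summit.Ventures.YMGap.RobustBall

end
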